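import Summits.CriticalPhenomena.PercolationContinuityZ3.Theorems.Transplant.SkelConcKitsWin
import Summits.CriticalPhenomena.PercolationContinuityZ3.Theorems.Transplant.SkelConcKits
import Summits.CriticalPhenomena.PercolationContinuityZ3.Theorems.Transplant.SkelSlabCube
import Summits.CriticalPhenomena.PercolationContinuityZ3.Theorems.Transplant.SkelCylRadFrame
import HarnessLib

/-!
# L5.15 part 2b (hp-8 g24): rooms of general orthant shape, the cube-discharged kit clause `kitClause_cube'`, and the assembled
# per-level kit clauses `hkits_level_route'` / `hkits_level_room'` of a window step with true target + rim

builds on p205010 (kernel theorem, internal audit signed; external expert review pending) — nothing in this file uses p205010.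
Lane `prim-bschramm`, typed by the `prim-hp-8` lineage (gen 24); helper file (`--supports stmt-CriticalPhenomena-4575 --as helper`).  NEW FILE
over `SkelConcKitsWin` (`SkelI.kitClause'`), `SkelConcKits` (`SkelI.hcon_win₂'`), p3-g4's `SkelSlabCube` (cube rooms) and `SkelRoom`.
* §1 `macroPiece_sub_mem_piece` (`u ∈ macroPiece c ℓ R g ⇒ φ u − φ c ∈ GM.piece g ℓ`), `macroPiece_subset_Win_of_piece`;
* §2 **`hcon_win₂_of_piece'`** — the per-contact dichotomy from STRAIGHT rooms of general orthant shape (`(box ℓ) + φ c ⊆ Dpl`,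
  `(piece g ℓ) + φ c ⊆ Tpl`, the shape `Skel.WinAdvData.roomR` delivers via `orthantFace_eq_piece`);
* §3 **`kitClause_cube'`** — `kitClause'` with the near face map `SkelI.cubeU` and every room hypothesis discharged by `SkelSlabCube`
  (p3-g4 2026-08-20T21:34:55Z recipe; p1-g7's `kitClause_cube` is the `am = δ²` instance);
* §4 **`hkits_level_route'`** (deep contacts by an abstract route clause under deepness — the face step) and **`hkits_level_room'`** (straight
  rooms at every footprint of the level box — corridor / root / inner steps): the 8-conjunct per-level clause of `KitsAt`/`kitsAt_tstep`.
[cite: KozmaNitzan2024, §4 Lemma 10 Steps III–V (pp. 19–22), Lemma 11 (pp. 22–23), Lemma 12 (p. 24)]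
-/

noncomputable section

open MeasureTheory
open scoped Classical

namespace Summit.CriticalPhenomena.PercolationContinuityZ3.Theorems

namespace Transplant

namespace SkelI

open Literature.Probability.Percolation Literature.Probability.LatticeModels SimpleGraph KNLevels KozmaNitzan
open Literature.Probability.Percolation.GM (HOct sp piece facePiece)
open Literature.Probability.Percolation.KozmaNitzan.Cells (oth oth_ne eq_oth_of_ne oth_oth)
open Literature.Barriers.CriticalPhenomena (graphBall graphBall_finite mem_graphBall_self graphBall_mono)
open Skel (winGraph winGraph_adj winGraph_le winLevel mem_winLevel_iff winLData winLData_X inNbr KitGeom fatSeq macroPiece fatRadius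
  cubeCtr cubeFace faceElt mem_fatSeq_iff cubeFace_subset_fatSeq mem_graphBall_of_mem_fatSeq)

variable {V : Type} [DecidableEq V] {G : SimpleGraph V} [G.LocallyFinite] (Φ : PlanarSkeletonConc G)

/-! ## §1 Quarter-pieces of general orthant shape inside planar windows -/

omit [DecidableEq V] in
/-- The footprint of a vertex of `macroPiece c ℓ R g`, relative to `φ c`, lies in the planar orthant piece `GM.piece g ℓ`. [folklore] -/
theorem macroPiece_sub_mem_piece {c u : V} {ℓ R : ℕ} {g : HOct 2} (hu : u ∈ macroPiece Φ c ℓ R g) : Φ.φ u - Φ.φ c ∈ piece g ℓ := by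
  rw [Skel.macroPiece, Finset.mem_filter, Skel.mem_cylBallFin] at hu
  rw [piece, Finset.mem_filter]
  exact ⟨(PlanarSkeleton.mem_cyl _ c ℓ _).1 (Φ.cylBall_subset_prism c ℓ _ hu.1).2, hu.2⟩

omit [DecidableEq V] in
/-- **A quarter-piece lies in the window over `P`** when its planar orthant piece, shifted to `φ c`, lies in `P` and `B_G(c, R) ⊆ B_G(w₀, R')`.
[folklore] -/
theorem macroPiece_subset_Win_of_piece {c w₀ : V} {ℓ R R' : ℕ} {g : HOct 2} {P : Finset (Site 2)}
    (hball : graphBall G c R ⊆ graphBall G w₀ R') (hP : (piece g ℓ).image (fun t => t + Φ.φ c) ⊆ P) :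
    macroPiece Φ c ℓ R g ⊆ Φ.Win w₀ P R' :=
  Skel.macroPiece_subset_Win Φ hball fun u hu =>
    hP (Finset.mem_image.2 ⟨Φ.φ u - Φ.φ c, macroPiece_sub_mem_piece Φ hu, sub_add_cancel _ _⟩)

/-! ## §2 The dichotomy from straight rooms of general orthant shape -/

section Rooms

variable [Countable V] {p : unitInterval} (hC : Φ.toPlanarSkeleton.CylSubcritical p) {msel : V → ℕ} {Ssc : Finset ℕ} {q : unitInterval}
  {δ : ℝ} {M : ℕ} {w₀ : V} {R : ℕ} {lo hi : Site 2} {j ℓs R' r₀ rs cU : ℕ} {Wt : Sym2 V → unitInterval} {D T : Finset V}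
  {Rt L'' Ldeep : ℕ} {Unear : V → Finset V}

/-- **The per-contact dichotomy `hcon` (guard margin `am ≤ δ²`) from STRAIGHT ROOMS of general orthant shape**: for every near contact a
route scale `ℓ ∈ Ssc`, `M < ℓ`, `ψ ℓ ≤ Ldeep`, with `Λ_ℓ + φ(c x) ⊆ Dpl` and `piece g ℓ + φ(c x) ⊆ Tpl` for some orthant `g`, where
`D ⊇ Win w₀ Dpl R` and `T ⊇ Win w₀ Tpl Rt`. [cite: KozmaNitzan2024, §4 Lemma 10 Step IV (p. 20), Lemma 11 (p. 23)] -/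
theorem hcon_win₂_of_piece' {am : ℝ} (ha : am ≤ δ ^ 2)
    (hUdef : ∀ x ∈ outerBoundary (winGraph G w₀ R) (winLevel Φ w₀ R lo hi j),
      (inNbr Φ w₀ R (Finset.Icc (lo - (j : Site 2)) (hi + (j : Site 2))) x) ∈ graphBall G w₀ (R - r₀) →
      Unear x = (cubeFace Φ hC (deepCtr Φ w₀ R (lo - (j : Site 2)) (hi + (j : Site 2)) ℓs M x) (exitDir Φ w₀ R (lo - (j : Site 2)) (hi + (j : Site 2)) x).1 (exitDir Φ w₀ R (lo - (j : Site 2)) (hi + (j : Site 2)) x).2 ℓs M))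
    (hU : NearFaceOKDeep Φ w₀ R lo hi j ℓs M R' r₀ rs cU Unear)
    (hTrim : ∀ v ∈ winLevel Φ w₀ R lo hi j, v ∉ graphBall G w₀ (Rt - L'') → v ∈ T) (hRL : Rt - L'' ≤ R - r₀)
    (hL : Ldeep + fatRadius Φ hC M ≤ L'') (hLR : L'' ≤ Rt) (hRtR : Rt ≤ R)
    (hWD : IsSubbox (winGraph G w₀ R) Wt q D) {Dpl Tpl : Finset (Site 2)} (hDpl : Φ.Win w₀ Dpl R ⊆ D) (hTpl : Φ.Win w₀ Tpl Rt ⊆ T)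
    (hroom : ∀ x ∈ outerBoundary (winGraph G w₀ R) (winLevel Φ w₀ R lo hi j),
      (inNbr Φ w₀ R (Finset.Icc (lo - (j : Site 2)) (hi + (j : Site 2))) x) ∈ graphBall G w₀ (R - r₀) →
      ∃ ℓ ∈ Ssc, M < ℓ ∧ fatRadius Φ hC ℓ ≤ Ldeep ∧ (box 2 ℓ).image (fun t => t + Φ.φ (cubeCtr Φ (deepCtr Φ w₀ R (lo - (j : Site 2)) (hi + (j : Site 2)) ℓs M x) (exitDir Φ w₀ R (lo - (j : Site 2)) (hi + (j : Site 2)) x).1 (exitDir Φ w₀ R (lo - (j : Site 2)) (hi + (j : Site 2)) x).2 ℓs M)) ⊆ Dpl ∧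
        ∃ g : HOct 2, (piece g ℓ).image (fun t => t + Φ.φ (cubeCtr Φ (deepCtr Φ w₀ R (lo - (j : Site 2)) (hi + (j : Site 2)) ℓs M x) (exitDir Φ w₀ R (lo - (j : Site 2)) (hi + (j : Site 2)) x).1 (exitDir Φ w₀ R (lo - (j : Site 2)) (hi + (j : Site 2)) x).2 ℓs M)) ⊆ Tpl) :
    ∀ x ∈ outerBoundary (winGraph G w₀ R) (winLevel Φ w₀ R lo hi j),
      (∃ u ∈ (slabGeomDeep Φ w₀ R lo hi j ℓs M R' r₀ Unear).U x, u ∈ T) ∨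
      ((inNbr Φ w₀ R (Finset.Icc (lo - (j : Site 2)) (hi + (j : Site 2))) x) ∈ graphBall G w₀ (R - r₀) ∧ ∀ t ∈ Φ.types,
        (∀ M' ∈ Ssc, 1 - am < (bondPercolation G q).real (UniqZone.zone G (fatSeq Φ hC (cubeCtr Φ (deepCtr Φ w₀ R (lo - (j : Site 2)) (hi + (j : Site 2)) ℓs M x) (exitDir Φ w₀ R (lo - (j : Site 2)) (hi + (j : Site 2)) x).1 (exitDir Φ w₀ R (lo - (j : Site 2)) (hi + (j : Site 2)) x).2 ℓs M)) (msel t) M') ∧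
          ∀ g' : HOct 2, 1 - am < (bondPercolation G q).real
            (linkIn (↑(fatSeq Φ hC (cubeCtr Φ (deepCtr Φ w₀ R (lo - (j : Site 2)) (hi + (j : Site 2)) ℓs M x) (exitDir Φ w₀ R (lo - (j : Site 2)) (hi + (j : Site 2)) x).1 (exitDir Φ w₀ R (lo - (j : Site 2)) (hi + (j : Site 2)) x).2 ℓs M) M')) (fatSeq Φ hC (cubeCtr Φ (deepCtr Φ w₀ R (lo - (j : Site 2)) (hi + (j : Site 2)) ℓs M x) (exitDir Φ w₀ R (lo - (j : Site 2)) (hi + (j : Site 2)) x).1 (exitDir Φ w₀ R (lo - (j : Site 2)) (hi + (j : Site 2)) x).2 ℓs M) (msel t)) (macroPiece Φ (cubeCtr Φ (deepCtr Φ w₀ R (lo - (j : Site 2)) (hi + (j : Site 2)) ℓs M x) (exitDir Φ w₀ R (lo - (j : Site 2)) (hi + (j : Site 2)) x).1 (exitDir Φ w₀ R (lo - (j : Site 2)) (hi + (j : Site 2)) x).2 ℓs M) M' (fatRadius Φ hC M') g'))) →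
        ∃ Qt Ft : Finset V, Ft ⊆ T ∧ Qt ⊆ D ∧ (∀ u ∈ Qt, ∀ v ∈ Qt, G.Adj u v → (winGraph G w₀ R).Adj u v) ∧
          Disjoint Ft (fatSeq Φ hC (cubeCtr Φ (deepCtr Φ w₀ R (lo - (j : Site 2)) (hi + (j : Site 2)) ℓs M x) (exitDir Φ w₀ R (lo - (j : Site 2)) (hi + (j : Site 2)) x).1 (exitDir Φ w₀ R (lo - (j : Site 2)) (hi + (j : Site 2)) x).2 ℓs M) M) ∧
          1 - δ ^ 2 < (prodBernoulli Wt).real (linkIn (↑Qt) (fatSeq Φ hC (cubeCtr Φ (deepCtr Φ w₀ R (lo - (j : Site 2)) (hi + (j : Site 2)) ℓs M x) (exitDir Φ w₀ R (lo - (j : Site 2)) (hi + (j : Site 2)) x).1 (exitDir Φ w₀ R (lo - (j : Site 2)) (hi + (j : Site 2)) x).2 ℓs M) (msel t)) Ft)) := by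
  refine hcon_win₂' Φ hC hUdef hU hTrim hRL hL hLR fun x hx hnear hdeep t _ hin => ?_
  obtain ⟨ℓ, hℓ, hMℓ, hψ, hroomD, g, hroomT⟩ := hroom x hx hnear
  have hballR : graphBall G (cubeCtr Φ (deepCtr Φ w₀ R (lo - (j : Site 2)) (hi + (j : Site 2)) ℓs M x) (exitDir Φ w₀ R (lo - (j : Site 2)) (hi + (j : Site 2)) x).1 (exitDir Φ w₀ R (lo - (j : Site 2)) (hi + (j : Site 2)) x).2 ℓs M) (fatRadius Φ hC ℓ) ⊆ graphBall G w₀ R :=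
    ((graphBall_mono G _ hψ).trans hdeep).trans (graphBall_mono G w₀ hRtR)
  have hballRt : graphBall G (cubeCtr Φ (deepCtr Φ w₀ R (lo - (j : Site 2)) (hi + (j : Site 2)) ℓs M x) (exitDir Φ w₀ R (lo - (j : Site 2)) (hi + (j : Site 2)) x).1 (exitDir Φ w₀ R (lo - (j : Site 2)) (hi + (j : Site 2)) x).2 ℓs M) (fatRadius Φ hC ℓ) ⊆ graphBall G w₀ Rt := (graphBall_mono G _ hψ).trans hdeep
  have hQD : fatSeq Φ hC (cubeCtr Φ (deepCtr Φ w₀ R (lo - (j : Site 2)) (hi + (j : Site 2)) ℓs M x) (exitDir Φ w₀ R (lo - (j : Site 2)) (hi + (j : Site 2)) x).1 (exitDir Φ w₀ R (lo - (j : Site 2)) (hi + (j : Site 2)) x).2 ℓs M) ℓ ⊆ D :=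
    (Skel.fatSeq_subset_Win Φ hC hballR fun y hy => hroomD (Finset.mem_image.2 ⟨y, hy, add_comm _ _⟩)).trans hDpl
  have hQ : ∀ u ∈ fatSeq Φ hC (cubeCtr Φ (deepCtr Φ w₀ R (lo - (j : Site 2)) (hi + (j : Site 2)) ℓs M x) (exitDir Φ w₀ R (lo - (j : Site 2)) (hi + (j : Site 2)) x).1 (exitDir Φ w₀ R (lo - (j : Site 2)) (hi + (j : Site 2)) x).2 ℓs M) ℓ, ∀ v ∈ fatSeq Φ hC (cubeCtr Φ (deepCtr Φ w₀ R (lo - (j : Site 2)) (hi + (j : Site 2)) ℓs M x) (exitDir Φ w₀ R (lo - (j : Site 2)) (hi + (j : Site 2)) x).1 (exitDir Φ w₀ R (lo - (j : Site 2)) (hi + (j : Site 2)) x).2 ℓs M) ℓ, G.Adj u v → (winGraph G w₀ R).Adj u v :=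
    Skel.adj_winGraph_of_subset_graphBall fun u hu => hballR (mem_graphBall_of_mem_fatSeq Φ hC hu)
  have hT : macroPiece Φ (cubeCtr Φ (deepCtr Φ w₀ R (lo - (j : Site 2)) (hi + (j : Site 2)) ℓs M x) (exitDir Φ w₀ R (lo - (j : Site 2)) (hi + (j : Site 2)) x).1 (exitDir Φ w₀ R (lo - (j : Site 2)) (hi + (j : Site 2)) x).2 ℓs M) ℓ (fatRadius Φ hC ℓ) g ⊆ T := (macroPiece_subset_Win_of_piece Φ hballRt hroomT).trans hTpl
  have hin' : ∀ M' ∈ Ssc, 1 - am < (bondPercolation G q).real (UniqZone.zone G (fatSeq Φ hC (cubeCtr Φ (deepCtr Φ w₀ R (lo - (j : Site 2)) (hi + (j : Site 2)) ℓs M x) (exitDir Φ w₀ R (lo - (j : Site 2)) (hi + (j : Site 2)) x).1 (exitDir Φ w₀ R (lo - (j : Site 2)) (hi + (j : Site 2)) x).2 ℓs M)) (msel t) M') ∧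
      ∀ g' : HOct 2, 1 - am < (bondPercolation G q).real
        (linkIn (↑(fatSeq Φ hC (cubeCtr Φ (deepCtr Φ w₀ R (lo - (j : Site 2)) (hi + (j : Site 2)) ℓs M x) (exitDir Φ w₀ R (lo - (j : Site 2)) (hi + (j : Site 2)) x).1 (exitDir Φ w₀ R (lo - (j : Site 2)) (hi + (j : Site 2)) x).2 ℓs M) M')) (fatSeq Φ hC (cubeCtr Φ (deepCtr Φ w₀ R (lo - (j : Site 2)) (hi + (j : Site 2)) ℓs M x) (exitDir Φ w₀ R (lo - (j : Site 2)) (hi + (j : Site 2)) x).1 (exitDir Φ w₀ R (lo - (j : Site 2)) (hi + (j : Site 2)) x).2 ℓs M) (msel t)) (macroPiece Φ (cubeCtr Φ (deepCtr Φ w₀ R (lo - (j : Site 2)) (hi + (j : Site 2)) ℓs M x) (exitDir Φ w₀ R (lo - (j : Site 2)) (hi + (j : Site 2)) x).1 (exitDir Φ w₀ R (lo - (j : Site 2)) (hi + (j : Site 2)) x).2 ℓs M) M' (fatRadius Φ hC M') g')) := hin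
  obtain ⟨Qt, Ft, h1, h2, h3, h4, h5⟩ := Skel.hcon_of_straight Φ hC (winGraph_le G w₀ R) hWD hℓ hMℓ hQD hQ hT hin'
  exact ⟨Qt, Ft, h1, h2, h3, h4, (sub_le_sub_left ha 1).trans_lt h5⟩

end Rooms

/-! ## §3 The kit clause with the cube rooms discharged -/

/-- **`kitClause'` with the near face map `SkelI.cubeU` and the ROOM hypotheses discharged** (`nearFaceOK_cube`, `cubeU_geom`,
`cube_subset_shellWin`, `cubeU_subset_innerBoundary_win`; the cylinder radius via `prism_subset_cylBall`).
[cite: KozmaNitzan2024, §4 Lemma 10 Steps III–IV (pp. 19–21)] -/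
theorem kitClause_cube' [Countable V] {p : unitInterval} (hC : Φ.toPlanarSkeleton.CylSubcritical p) (msel : V → ℕ) {Ssc : Finset ℕ}
    {q : unitInterval} {δ : ℝ} (hδ : 0 < δ) {am : ℝ} (ham : am ≤ δ ^ 2)
    (hin : ∀ i ∈ Skel.inputIndex Φ Ssc, 1 - am < (bondPercolation G q).real (Skel.inputEvent Φ hC msel i))
    {M : ℕ} (hM : M ∈ Ssc) (hmsel : ∀ t ∈ Φ.types, msel t ≤ M)
    {w₀ : V} {R : ℕ} {lo hi : Site 2} {j ℓs R' r₀ rs : ℕ} (hMℓ : M + 1 ≤ ℓs)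
    (hwide : ∀ i, (lo - (j : Site 2)) i + 2 * tanOff ℓs M ≤ (hi + (j : Site 2)) i)
    (hR'₁ : Φ.cylRadMax ℓs (ℓs + 2 + 2 * tanOff ℓs M) ≤ R') (hR'₂ : Φ.cylRadMax ℓs (ℓs + 2 + M + fatRadius Φ hC M) ≤ R')
    (hr₀₁ : ℓs + 1 + tanOff ℓs M + R' ≤ r₀) (hr₀₂ : 2 * ℓs + 2 + tanOff ℓs M + M + fatRadius Φ hC M ≤ r₀) (hR : r₀ ≤ R)
    (hrs₁ : ℓs + 2 + tanOff ℓs M + R' ≤ rs) (hrs₂ : 2 * ℓs + 3 + tanOff ℓs M + M + fatRadius Φ hC M ≤ rs)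
    (k : ℕ) (o : V) (Sfin : Finset V) {Wt : Sym2 V → unitInterval} {D T : Finset V}
    (hWD : IsSubbox (winGraph G w₀ R) Wt q D) (hXD : winLevel Φ w₀ R lo hi j ⊆ D) {N : ℕ}
    (hN : k * (Φ.Δ + 1) ^ (2 * rs) ≤ N)
    (hk : (1 - (q : ℝ) ^ (1 + Φ.Δ * ((Φ.Δ + 1) ^ R' + (tanOff ℓs M + 2)) +
      ((Φ.Δ + 1) ^ R' + (tanOff ℓs M + 2)) * (Φ.Δ + 1) ^ fatRadius Φ hC M)) ^ k ≤ δ)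
    (hcon : ∀ x ∈ outerBoundary (winGraph G w₀ R) (winLevel Φ w₀ R lo hi j),
      (∃ u ∈ (slabGeomDeep Φ w₀ R lo hi j ℓs M R' r₀ (cubeU Φ hC w₀ R lo hi j ℓs M)).U x, u ∈ T) ∨
      ((inNbr Φ w₀ R (Finset.Icc (lo - (j : Site 2)) (hi + (j : Site 2))) x) ∈ graphBall G w₀ (R - r₀) ∧ ∀ t ∈ Φ.types,
        (∀ M' ∈ Ssc, 1 - am < (bondPercolation G q).real (UniqZone.zone G (fatSeq Φ hC (cubeCtr Φ (deepCtr Φ w₀ R (lo - (j : Site 2)) (hi + (j : Site 2)) ℓs M x) (exitDir Φ w₀ R (lo - (j : Site 2)) (hi + (j : Site 2)) x).1 (exitDir Φ w₀ R (lo - (j : Site 2)) (hi + (j : Site 2)) x).2 ℓs M)) (msel t) M') ∧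
          ∀ g' : HOct 2, 1 - am < (bondPercolation G q).real
            (linkIn (↑(fatSeq Φ hC (cubeCtr Φ (deepCtr Φ w₀ R (lo - (j : Site 2)) (hi + (j : Site 2)) ℓs M x) (exitDir Φ w₀ R (lo - (j : Site 2)) (hi + (j : Site 2)) x).1 (exitDir Φ w₀ R (lo - (j : Site 2)) (hi + (j : Site 2)) x).2 ℓs M) M')) (fatSeq Φ hC (cubeCtr Φ (deepCtr Φ w₀ R (lo - (j : Site 2)) (hi + (j : Site 2)) ℓs M x) (exitDir Φ w₀ R (lo - (j : Site 2)) (hi + (j : Site 2)) x).1 (exitDir Φ w₀ R (lo - (j : Site 2)) (hi + (j : Site 2)) x).2 ℓs M) (msel t)) (macroPiece Φ (cubeCtr Φ (deepCtr Φ w₀ R (lo - (j : Site 2)) (hi + (j : Site 2)) ℓs M x) (exitDir Φ w₀ R (lo - (j : Site 2)) (hi + (j : Site 2)) x).1 (exitDir Φ w₀ R (lo - (j : Site 2)) (hi + (j : Site 2)) x).2 ℓs M) M' (fatRadius Φ hC M') g'))) →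
        ∃ Qt Ft : Finset V, Ft ⊆ T ∧ Qt ⊆ D ∧ (∀ u ∈ Qt, ∀ v ∈ Qt, G.Adj u v → (winGraph G w₀ R).Adj u v) ∧
          Disjoint Ft (fatSeq Φ hC (cubeCtr Φ (deepCtr Φ w₀ R (lo - (j : Site 2)) (hi + (j : Site 2)) ℓs M x) (exitDir Φ w₀ R (lo - (j : Site 2)) (hi + (j : Site 2)) x).1 (exitDir Φ w₀ R (lo - (j : Site 2)) (hi + (j : Site 2)) x).2 ℓs M) M) ∧
          1 - δ ^ 2 < (prodBernoulli Wt).real (linkIn (↑Qt) (fatSeq Φ hC (cubeCtr Φ (deepCtr Φ w₀ R (lo - (j : Site 2)) (hi + (j : Site 2)) ℓs M x) (exitDir Φ w₀ R (lo - (j : Site 2)) (hi + (j : Site 2)) x).1 (exitDir Φ w₀ R (lo - (j : Site 2)) (hi + (j : Site 2)) x).2 ℓs M) (msel t)) Ft))) :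
    ∃ (σ : SData V) (S : Finset V), SHyp (winLData Φ w₀ R lo hi o Sfin) j σ ∧ σ.N ≤ N ∧
      (1 - (q : ℝ) ^ σ.sB) ^ σ.k ≤ δ ∧ S ⊆ (winLData Φ w₀ R lo hi o Sfin).X j ∧ S ⊆ D ∧
      (∀ x ∈ σ.K, ∀ e ∈ σ.seed x, e ∉ wireSet (↑S : Set V)) ∧ (∀ x ∈ σ.K, σ.face x ⊆ S) ∧
      (∀ x ∈ σ.K, 1 - 3 * δ ≤ (prodBernoulli Wt).real {ω | ∃ u ∈ σ.face x,
        1 - δ < (prodBernoulli (pinW Wt (wireSet (↑S : Set V)) ω)).real (⋃ t ∈ T, openConnIn (↑D : Set V) u t)}) := by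
  have hℓ : 1 ≤ ℓs := by omega
  refine kitClause' Φ hC msel hδ ham hin hM hmsel hℓ hwide (fun c v hv => ?_) hr₀₁ hR hrs₁
    (nearFaceOK_cube Φ hC hMℓ hwide hR'₂ hr₀₂ hR hrs₂ le_rfl) (fun x _ _ => rfl) (fun x hx u hu => (cubeU_geom Φ hC hwide hx hu).2.2)
    (fun x hx hnear => ⟨cube_subset_shellWin Φ hC hwide hr₀₂ hR hx hnear,
      cubeU_subset_innerBoundary_win Φ hC hMℓ hwide hR'₂ hr₀₁ hr₀₂ hR hx hnear⟩) k o Sfin hWD hXD hN hk hcon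
  exact Skel.cylBall_mono Φ c le_rfl hR'₁ (Φ.prism_subset_cylBall c hℓ (ℓs + 2 + 2 * tanOff ℓs M) ⟨hv.1, hv.2⟩)

end SkelI

end Transplant

end Summit.CriticalPhenomena.PercolationContinuityZ3.Theorems

end
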